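import Summits.NavierStokesRegularity.NavierStokesRegularity.Theorems.PalasekTowerBreakdownEpisodeBaseStrainPairing
import Summits.NavierStokesRegularity.NavierStokesRegularity.Theorems.PalasekTowerBreakdownEpisodeBaseStrainGronwall
import Literature.Analysis.FluidPDE.ClassicalSolution

/-!
# The strain-currency door at the `L²` level, modulo the energy-differentiability interface

Cell `ns-blowup`, seat `ns-palasek-19179-p2` (g6; holder-of-record lineage of crux
stmt-NavierStokesRegularity-19179 `EpisodeBase`, route `PalasekTowerBreakdown`; `--supports
stmt-NavierStokesRegularity-19179`). Support for the stub `stub_strain_door : StrainDoor` of the strategist line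
`Cruxes/EpisodeBase/Lines/straindoor.lean` (cstrat-19179, v2). LABEL: E–C analysis (KERNEL: theorems only; no
definition, no named fact, no `sorry`; register-free — any finite-dimensional real inner product space `E`, any
window `[t₀, t₁]`, unit viscosity). WHAT THIS IS NOT: not Navier–Stokes evidence — a conditional stability estimate
between two GIVEN classical runs; no run, design, certificate or blow-up is exhibited or asserted; it does NOT prove
`StrainDoor` (no existence statement, `L²` level only).

THE STATEMENT (`sqrt_energy_sub_le_of_classical_runs`). Let `(v, q)` solve Navier–Stokes at `ν = 1` with force `0`
and `(w, ϖ)` with force `r` (its residual) on `[t₀, t₁] × E`, both classically; assume the slices `v t`, `w t` are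
smooth `L²` fields, the pressure DIFFERENCE slices `q t − ϖ t` are smooth `L²` scalars (so the pressure does no work
on the divergence-free difference), `‖r t‖_{L²} ≤ G`, and the STRAIN MAJORANT `|⟪Dw(t,x) ξ, ξ⟫| ≤ σ(t) ‖ξ‖²` with
`σ ≥ 0` continuous. Assume the ENERGY-DIFFERENTIABILITY INTERFACE: `s ↦ ∫ ‖v s − w s‖²` is continuous on the window
and has, within `[t, ∞)` at every `t ∈ [t₀, t₁)`, the derivative `2 ∫ ⟪∂ₜv − ∂ₜw, v − w⟫` (the formal one; this is
what a door prover discharges from Tao-class regularity by dominated convergence / Fubini). THEN for `t ∈ [t₀, t₁]`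

  `‖v t − w t‖_{L²} ≤ (‖v t₀ − w t₀‖_{L²} + G (t − t₀)) · exp (∫_{t₀}^t σ)`.

NO `‖w‖_∞`, NO `‖Dw‖_∞`: the transport term `⟪(w·∇)w̃, w̃⟫` and the cubic term `⟪(w̃·∇)w̃, w̃⟫` integrate to zero
(`FluidPDE.integral_inner_convect_eq_zero`), the Laplacian is dissipative (`IsSmoothL2Field.integral_inner_laplacian`),
the pressure drops (`IsSmoothL2Field.integral_inner_gradient`), the stretching term costs `σ` (Part I,
`abs_integral_inner_convect_le_of_strain`), the residual costs `G √E` (Cauchy–Schwarz), and the square-root Grönwall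
lemma `sqrt_le_gronwall_of_deriv_le` closes. This is the level-0 instance of the door's estimate (the card's rate `2σ`
at `L²`); the `H¹`/`H²` levels repeat the pattern with Parts II–V and the explicit Agmon inequality for the sup-closeness.

References: J. Serrin, Arch. Rational Mech. Anal. 3 (1959) (energy stability in the symmetric gradient);
C. R. Doering, J. D. Gibbon, CUP 1995, §2.3 [cite: DoeringGibbon1995, §2.3 (2.3.29)–(2.3.31)]; M. Dashti, J. C. Robinson,
SIAM J. Numer. Anal. 46 (2008), Thm. 5 [cite: DashtiRobinson2008, Thm. 5].
-/

noncomputable section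

set_option linter.dupNamespace false

open MeasureTheory Filter Function Set
open scoped ENNReal NNReal RealInnerProductSpace Topology Laplacian
open Literature.Analysis.FunctionSpaces Literature.Analysis.FluidPDE

namespace Summit.NavierStokesRegularity.NavierStokesRegularity.Theorems.StrainPairing

variable {E : Type*} [NormedAddCommGroup E] [InnerProductSpace ℝ E] [FiniteDimensional ℝ E]
  [MeasurableSpace E] [BorelSpace E]
variable {E' : Type*} [NormedAddCommGroup E'] [InnerProductSpace ℝ E']

/-! ## Small tools -/

omit [FiniteDimensional ℝ E] [MeasurableSpace E] [BorelSpace E] in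
/-- Differences of smooth `L²` fields are smooth `L²` fields. [cite: DoeringGibbon1995, §2.3 (2.3.29)–(2.3.31)] -/
theorem isSmoothL2Field_sub [FiniteDimensional ℝ E] [MeasurableSpace E] [BorelSpace E] {f g : E → E'}
    (hf : IsSmoothL2Field f) (hg : IsSmoothL2Field g) : IsSmoothL2Field (fun x => f x - g x) := by
  have h := hf.add (hg.const_smul (-1))
  have he : (f + (-1 : ℝ) • g) = fun x => f x - g x := by
    funext x; simp [sub_eq_add_neg]
  rwa [he] at h

omit [FiniteDimensional ℝ E] [MeasurableSpace E] [BorelSpace E] in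
/-- Differences of divergence-free differentiable fields are divergence free (the divergence is the trace of the
derivative). [cite: DoeringGibbon1995, §2.3 (2.3.29)–(2.3.31)] -/
theorem isDivFree_sub {f g : E → E} (hf : VectorCalculus.IsDivFree f) (hg : VectorCalculus.IsDivFree g)
    (hfd : Differentiable ℝ f) (hgd : Differentiable ℝ g) : VectorCalculus.IsDivFree (fun x => f x - g x) := by
  intro x
  have h1 := hf x
  have h2 := hg x
  simp only [VectorCalculus.divergence] at h1 h2 ⊢
  have hsub : (fun x => f x - g x) = f - g := rfl
  rw [hsub, fderiv_sub (hfd x) (hgd x)]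
  simp [h1, h2]

/-- Cauchy–Schwarz for the `L²` pairing of two square-integrable fields:
`∫ ⟪f, g⟫ ≤ √(∫‖f‖²) √(∫‖g‖²)`. [cite: DoeringGibbon1995, §2.3 (2.3.29)–(2.3.31)] -/
theorem integral_inner_le_sqrt_mul_sqrt {f g : E → E'} (hf : MemLp f 2 volume) (hg : MemLp g 2 volume) :
    ∫ x, ⟪f x, g x⟫ ≤ Real.sqrt (∫ x, ‖f x‖ ^ 2) * Real.sqrt (∫ x, ‖g x‖ ^ 2) := by
  have h1 : ∫ x, ⟪f x, g x⟫ ≤ ∫ x, ‖f x‖ * ‖g x‖ :=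
    integral_mono (integrable_inner_of_memLp_two hf hg) (hf.norm.integrable_mul hg.norm)
      fun x => real_inner_le_norm _ _
  have h2 := integral_mul_le_Lp_mul_Lq_of_nonneg (μ := (volume : Measure E)) Real.HolderConjugate.two_two
    (Eventually.of_forall fun x => norm_nonneg (f x)) (Eventually.of_forall fun x => norm_nonneg (g x))
    (by simpa using hf.norm) (by simpa using hg.norm)
  refine h1.trans (h2.trans (le_of_eq ?_))
  rw [Real.sqrt_eq_rpow, Real.sqrt_eq_rpow]
  norm_num

/-! ## The `L²` door modulo the energy-differentiability interface -/

/-- **Strain-currency stability at the `L²` level (modulo the energy-differentiability interface).** See the module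
docstring: two classical runs at unit viscosity, `v` free and `w` forced by its residual `r` with `‖r t‖₂ ≤ G`, smooth
`L²` slices, smooth `L²` pressure difference, strain majorant `σ ≥ 0` continuous; if `s ↦ ∫‖v s − w s‖²` is continuous on
`[t₀, t₁]` with the formal right derivative `2∫⟪∂ₜv − ∂ₜw, v − w⟫` on `[t₀, t₁)`, then
`√(∫‖v t − w t‖²) ≤ (√(∫‖v t₀ − w t₀‖²) + G (t − t₀)) · exp (∫_{t₀}^t σ)` on the window.
[cite: DashtiRobinson2008, Thm. 5] [cite: DoeringGibbon1995, §2.3 (2.3.29)–(2.3.31)] -/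
theorem sqrt_energy_sub_le_of_classical_runs {v w r : ℝ → E → E} {q ϖ : ℝ → E → ℝ} {t₀ t₁ G : ℝ}
    {σ : ℝ → ℝ}
    (hv : IsClassicalNSSolutionOn (Icc t₀ t₁) 1 0 v q) (hw : IsClassicalNSSolutionOn (Icc t₀ t₁) 1 r w ϖ)
    (hvS : ∀ t ∈ Icc t₀ t₁, IsSmoothL2Field (v t)) (hwS : ∀ t ∈ Icc t₀ t₁, IsSmoothL2Field (w t))
    (hπS : ∀ t ∈ Icc t₀ t₁, IsSmoothL2Field (fun x => q t x - ϖ t x))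
    (hrm : ∀ t ∈ Icc t₀ t₁, MemLp (r t) 2 volume) (hG : 0 ≤ G)
    (hrG : ∀ t ∈ Icc t₀ t₁, Real.sqrt (∫ x, ‖r t x‖ ^ 2) ≤ G)
    (hσ : Continuous σ) (hσ0 : ∀ t, 0 ≤ σ t)
    (hstrain : ∀ t ∈ Icc t₀ t₁, ∀ x ξ : E, |⟪fderiv ℝ (w t) x ξ, ξ⟫| ≤ σ t * ‖ξ‖ ^ 2)
    (hEc : ContinuousOn (fun s => ∫ x, ‖v s x - w s x‖ ^ 2) (Icc t₀ t₁))
    (hEd : ∀ t ∈ Ico t₀ t₁, HasDerivWithinAt (fun s => ∫ x, ‖v s x - w s x‖ ^ 2)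
      (2 * ∫ x, ⟪timeDerivWithin (Icc t₀ t₁) v t x - timeDerivWithin (Icc t₀ t₁) w t x, v t x - w t x⟫)
      (Ici t) t) :
    ∀ t ∈ Icc t₀ t₁, Real.sqrt (∫ x, ‖v t x - w t x‖ ^ 2) ≤
      (Real.sqrt (∫ x, ‖v t₀ x - w t₀ x‖ ^ 2) + G * (t - t₀)) * Real.exp (∫ s in t₀..t, σ s) := by
  refine sqrt_le_gronwall_of_deriv_le (E := fun s => ∫ x, ‖v s x - w s x‖ ^ 2)
    (E' := fun t => 2 * ∫ x, ⟪timeDerivWithin (Icc t₀ t₁) v t x - timeDerivWithin (Icc t₀ t₁) w t x, v t x - w t x⟫)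
    hEc hEd (fun t _ => integral_nonneg fun x => sq_nonneg _) hσ hσ0 hG fun t ht => ?_
  have ht' : t ∈ Icc t₀ t₁ := Ico_subset_Icc_self ht
  -- the difference and its regularity
  set W : E → E := fun x => v t x - w t x with hWdef
  have hW : IsSmoothL2Field W := isSmoothL2Field_sub (hvS t ht') (hwS t ht')
  have hwB : HasBoundedDerivs (w t) := (hwS t ht').toHasBoundedDerivs
  have hvd : Differentiable ℝ (v t) := (hvS t ht').contDiff.differentiable (by simp)
  have hwd : Differentiable ℝ (w t) := (hwS t ht').contDiff.differentiable (by simp)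
  have hWdiv : VectorCalculus.IsDivFree W :=
    isDivFree_sub (hv.divFree t ht') (hw.divFree t ht') hvd hwd
  set π : E → ℝ := fun x => q t x - ϖ t x with hπdef
  have hπ : IsSmoothL2Field π := hπS t ht'
  -- the pointwise equation for `∂ₜW`
  have hqd : Differentiable ℝ (q t) := (hv.contDiff_pressure ht').differentiable (by simp)
  have hϖd : Differentiable ℝ (ϖ t) := (hw.contDiff_pressure ht').differentiable (by simp)
  have hgradπ : ∀ x, gradient π x = gradient (q t) x - gradient (ϖ t) x := by
    intro x
    simp only [gradient, hπdef]
    have : (fun x => q t x - ϖ t x) = q t - ϖ t := rfl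
    rw [this, fderiv_sub (hqd x) (hϖd x), map_sub]
  have hconv : ∀ x, convect (v t) (v t) x - convect (w t) (w t) x =
      convect W (w t) x + convect (w t) W x + convect W W x := by
    intro x
    simp only [convect_apply, hWdef]
    have hsub : (fun x => v t x - w t x) = v t - w t := rfl
    rw [hsub, fderiv_sub (hvd x) (hwd x)]
    simp only [sub_apply, map_sub]
    abel
  have hpt : ∀ x, timeDerivWithin (Icc t₀ t₁) v t x - timeDerivWithin (Icc t₀ t₁) w t x =
      (Δ W) x - (convect W (w t) x + convect (w t) W x + convect W W x) - gradient π x - r t x := by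
    intro x
    have h1 := hv.momentum t ht' x
    have h2 := hw.momentum t ht' x
    simp only [Pi.zero_apply, add_zero, one_smul] at h1 h2
    have hΔ : (Δ W) x = (Δ (v t)) x - (Δ (w t)) x := by
      have hsub : W = v t - w t := rfl
      rw [hsub]
      exact ((hvS t ht').contDiff_nat 2).contDiffAt.laplacian_sub ((hwS t ht').contDiff_nat 2).contDiffAt
    rw [hΔ, ← hconv, hgradπ]
    have e1 : timeDerivWithin (Icc t₀ t₁) v t x = (Δ (v t)) x - gradient (q t) x - convect (v t) (v t) x :=
      eq_sub_of_add_eq h1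
    have e2 : timeDerivWithin (Icc t₀ t₁) w t x =
        (Δ (w t)) x - gradient (ϖ t) x + r t x - convect (w t) (w t) x := eq_sub_of_add_eq h2
    rw [e1, e2]
    abel
  -- integrability of the six pairings against `W`
  have hW2 : MemLp W 2 volume := hW.memLp_two
  have iΔ : Integrable (fun x => ⟪(Δ W) x, W x⟫) volume :=
    integrable_inner_of_memLp_two hW.laplacian.memLp_two hW2
  have iN₁ : Integrable (fun x => ⟪convect W (w t) x, W x⟫) volume :=
    integrable_inner_of_memLp_two ((hwS t ht').convect hW.toHasBoundedDerivs).memLp_two hW2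
  have iN₂ : Integrable (fun x => ⟪convect (w t) W x, W x⟫) volume :=
    integrable_inner_of_memLp_two (hW.convect hwB).memLp_two hW2
  have iN₃ : Integrable (fun x => ⟪convect W W x, W x⟫) volume :=
    integrable_inner_of_memLp_two (hW.convect hW.toHasBoundedDerivs).memLp_two hW2
  have iπ : Integrable (fun x => ⟪gradient π x, W x⟫) volume :=
    integrable_inner_of_memLp_two hπ.gradient.memLp_two hW2
  have ir : Integrable (fun x => ⟪r t x, W x⟫) volume := integrable_inner_of_memLp_two (hrm t ht') hW2
  -- the values of the pairings
  have vΔ : ∫ x, ⟪(Δ W) x, W x⟫ ≤ 0 := by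
    have h := hW.integral_inner_laplacian
    have hcomm : ∫ x, ⟪(Δ W) x, W x⟫ = ∫ x, ⟪W x, (Δ W) x⟫ :=
      integral_congr_ae (Eventually.of_forall fun x => real_inner_comm _ _)
    rw [hcomm, h, neg_nonpos]
    exact Finset.sum_nonneg fun i _ => integral_nonneg fun x => sq_nonneg _
  have vN₁ : -∫ x, ⟪convect W (w t) x, W x⟫ ≤ σ t * ∫ x, ‖W x‖ ^ 2 :=
    (neg_le_abs _).trans (abs_integral_inner_convect_le_of_strain hW (hstrain t ht'))
  have vN₂ : ∫ x, ⟪convect (w t) W x, W x⟫ = 0 := by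
    have hcomm : ∫ x, ⟪convect (w t) W x, W x⟫ = ∫ x, ⟪W x, convect (w t) W x⟫ :=
      integral_congr_ae (Eventually.of_forall fun x => real_inner_comm _ _)
    rw [hcomm]; exact integral_inner_convect_eq_zero hwB (hw.divFree t ht') hW
  have vN₃ : ∫ x, ⟪convect W W x, W x⟫ = 0 := by
    have hcomm : ∫ x, ⟪convect W W x, W x⟫ = ∫ x, ⟪W x, convect W W x⟫ :=
      integral_congr_ae (Eventually.of_forall fun x => real_inner_comm _ _)
    rw [hcomm]; exact integral_inner_convect_eq_zero hW.toHasBoundedDerivs hWdiv hW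
  have vπ : ∫ x, ⟪gradient π x, W x⟫ = 0 := by
    have hcomm : ∫ x, ⟪gradient π x, W x⟫ = ∫ x, ⟪W x, gradient π x⟫ :=
      integral_congr_ae (Eventually.of_forall fun x => real_inner_comm _ _)
    rw [hcomm, hW.integral_inner_gradient hπ]
    simp only [hWdiv _, zero_mul, integral_zero, neg_zero]
  have vr : -∫ x, ⟪r t x, W x⟫ ≤ G * Real.sqrt (∫ x, ‖W x‖ ^ 2) := by
    have h1 : -∫ x, ⟪r t x, W x⟫ = ∫ x, ⟪-(r t x), W x⟫ := by
      rw [← integral_neg]; exact integral_congr_ae (Eventually.of_forall fun x => by simp [inner_neg_left])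
    rw [h1]
    refine (integral_inner_le_sqrt_mul_sqrt (hrm t ht').neg hW2).trans ?_
    refine mul_le_mul_of_nonneg_right ?_ (Real.sqrt_nonneg _)
    have : (∫ x, ‖(-r t) x‖ ^ 2) = ∫ x, ‖r t x‖ ^ 2 :=
      integral_congr_ae (Eventually.of_forall fun x => by simp)
    rw [this]; exact hrG t ht'
  -- assemble: `2 ∫ ⟪∂ₜW, W⟫ ≤ 2 σ E + 2 G √E`
  have hsplit : ∫ x, ⟪timeDerivWithin (Icc t₀ t₁) v t x - timeDerivWithin (Icc t₀ t₁) w t x, v t x - w t x⟫ =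
      (∫ x, ⟪(Δ W) x, W x⟫) - ((∫ x, ⟪convect W (w t) x, W x⟫) + (∫ x, ⟪convect (w t) W x, W x⟫) +
        ∫ x, ⟪convect W W x, W x⟫) - (∫ x, ⟪gradient π x, W x⟫) - ∫ x, ⟪r t x, W x⟫ := by
    have hpt' : ∀ x, ⟪timeDerivWithin (Icc t₀ t₁) v t x - timeDerivWithin (Icc t₀ t₁) w t x, v t x - w t x⟫ =
        ⟪(Δ W) x, W x⟫ - (⟪convect W (w t) x, W x⟫ + ⟪convect (w t) W x, W x⟫ + ⟪convect W W x, W x⟫) -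
          ⟪gradient π x, W x⟫ - ⟪r t x, W x⟫ := by
      intro x
      rw [hpt x]
      simp only [inner_sub_left, inner_add_left, hWdef]
    have i12 : Integrable (fun x => ⟪convect W (w t) x, W x⟫ + ⟪convect (w t) W x, W x⟫) volume := iN₁.add iN₂
    have i3 : Integrable (fun x => ⟪convect W (w t) x, W x⟫ + ⟪convect (w t) W x, W x⟫ + ⟪convect W W x, W x⟫)
        volume := i12.add iN₃
    have i2 : Integrable (fun x => ⟪(Δ W) x, W x⟫ -
        (⟪convect W (w t) x, W x⟫ + ⟪convect (w t) W x, W x⟫ + ⟪convect W W x, W x⟫)) volume := iΔ.sub i3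
    have i1 : Integrable (fun x => ⟪(Δ W) x, W x⟫ -
        (⟪convect W (w t) x, W x⟫ + ⟪convect (w t) W x, W x⟫ + ⟪convect W W x, W x⟫) - ⟪gradient π x, W x⟫)
        volume := i2.sub iπ
    simp_rw [hpt']
    rw [integral_sub i1 ir, integral_sub i2 iπ, integral_sub iΔ i3, integral_add i12 iN₃, integral_add iN₁ iN₂]
  show 2 * ∫ x, ⟪timeDerivWithin (Icc t₀ t₁) v t x - timeDerivWithin (Icc t₀ t₁) w t x, v t x - w t x⟫ ≤
    2 * σ t * (∫ x, ‖v t x - w t x‖ ^ 2) + 2 * G * Real.sqrt (∫ x, ‖v t x - w t x‖ ^ 2)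
  rw [hsplit, vN₂, vN₃, vπ]
  have hWn : (∫ x, ‖v t x - w t x‖ ^ 2) = ∫ x, ‖W x‖ ^ 2 := rfl
  rw [hWn]
  linarith [vΔ, vN₁, vr]

end Summit.NavierStokesRegularity.NavierStokesRegularity.Theorems.StrainPairing

end
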